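import Summits.SmoothPoincare4.SmoothPoincare4.Theorems.WeakReductionDescentLowGenusBase
import Literature.Topology.FourManifolds.Trisections
import Literature.Topology.FourManifolds.PropertyRTraceClosing
import Literature.Topology.FourManifolds.MorseTwoCriticalPoints
import Literature.Topology.FourManifolds.AkbulutKirbyCerfReduction
import Literature.Topology.FourManifolds.SPC4HandlesImpliesCerf
import Literature.Topology.FourManifolds.HeegaardSplittingMorse
import Literature.Topology.FourManifolds.MorseProofs
import Literature.Topology.FourManifolds.TrisectionHandleDecomposition

/-!
# SmoothPoincare4 / WeakReductionDescent — `LowGenusBase` from three leaves (item stmt-SmoothPoincare4-17911)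

Fact decomposition of the support item `LowGenusBase` (rungs `g ≤ 2`: a smooth homotopy 4-sphere
with a Gay–Kirby trisection of genus `≤ 2` is diffeomorphic to `S⁴`; equivalently the tree's named
fact `Literature.Barriers.SmoothPoincare4.mz_genus_le_two_homotopySphere_gk.{0}`,
`LowGenusBase_iff_mz`).  By `LowGenusBase_iff_cases` (Part II of
`WeakReductionDescentLowGenusBase.lean`) the item is the conjunction of two normalised slices,
(A) type `(g; g, 0, 0)` and (B) type `(2; 1, 1, 0)`.  Here both slices — hence the item — are
PROVED from three named facts, two of which are long-catalogued leaves of the tree: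

* `gkTrisection_exists_isMorse_isSelfIndexing` (**new leaf**, stated below for relocation to
  `Literature/Topology/FourManifolds/`): Gay–Kirby 2016, Lemma 13 — a `(g; k₀, k₁, k₂)`-trisected
  closed 4-manifold has a handle decomposition with one `0`-handle, `k₀` `1`-handles, `g − k₁`
  `2`-handles, `k₂` `3`-handles and one `4`-handle (Meier–Schirmer–Zupan 2016, §4, unbalanced
  bookkeeping), rendered in the tree's Morse-theoretic idiom (`SPC4Handles.lean` (b)) as a
  self-indexing Morse function with these critical-point counts;
* `Literature.Topology.FourManifolds.propertyR_exists_isBoundaryGluing_sphere_four` (existing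
  leaf, `PropertyRTraceClosing.lean`: Gabai's Property R in 4-dimensional handle form — a
  `B⁴ ∪ h²` with boundary `S¹ × S²` closes up to the round `S⁴`);
* `Literature.Topology.FourManifolds.exists_diffeomorph_comp_incl_eq` (existing leaf,
  `SPC4Handles.lean` (c): Laudenbach–Poénaru's extension theorem; it contains Cerf's `Γ₄ = 0`,
  `cerf_twistedSphere_four_of_exists_diffeomorph_comp_incl_eq`).

The proofs: after relabelling the sectors (`IsGKTrisection.comp_perm`), slice (A) is the type
`(0, g, 0)`, whose Morse function has exactly two critical points (index `0` and `4`), so `M` is a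
twisted sphere (`IsMorse.exists_isTwistedSphere_of_ncard_criticalSet_eq_two`, Milnor's Thm. 4.1)
and `≅ S⁴` by `Γ₄ = 0`; slice (B) is the type `(0, 1, 1)`, whose Morse function, cut at the
regular level `5/2` (`RegularSublevel.isBoundaryGluing_split`), exhibits `M = P ∪ V` with `P` a
`(1, 0, 1)` 2-handlebody and `V` a compact connected orientable `(1, 1)`-handlebody, whence
`M ≅ S⁴` by `nonempty_diffeomorph_sphere_of_isBoundaryGluing_oneTwoHandle_of_facts`
(Gompf–Scharlemann–Thompson Prop. 9.2 for one 2-handle, proved in the tree from the two leaves).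

So the trust base of the rung `g ≤ 2` of this route becomes {GK Lemma 13 (4-dimensional handle
theory over `IsGKTrisection`), Property R, Laudenbach–Poénaru} instead of the opaque
Meier–Schirmer–Zupan classification fact `msz_homotopySphere_gk`.

References: [GayKirby2016] Lemma 13, Thm. 4, Remark 2 · [MeierSchirmerZupan2016] §4 (Def. 4.1,
Lemma 4.6), Remark 3.12, Thm. 1.2 · [GompfScharlemannThompson2010] Prop. 9.2 · [GabaiJDG1987]
Cor. 8.3 · [LaudenbachPoenaruBSMF1972] Thm. A · [CerfDiffeoSphere1968] Γ₄ = 0 · [Milnor1963]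
Thms. 3.1, 3.2, 4.1 · [MilnorHCobordism1965] Thm. 4.8.
-/

-- the registered namespace `Summit.SmoothPoincare4.SmoothPoincare4.Theorems` repeats a component
set_option linter.dupNamespace false

noncomputable section

namespace Summit.SmoothPoincare4.SmoothPoincare4.Theorems

open scoped Manifold ContDiff ContinuousMap
open Set Literature.Topology.FourManifolds

/-- **Slice (A) from Gay–Kirby's Lemma 13 and Cerf's `Γ₄ = 0`.**  A smooth homotopy 4-sphere `M`
(bare binders, `e : M ≃ₕ S⁴`) with a `(g; g, 0, 0)` Gay–Kirby trisection is diffeomorphic to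
`S⁴`, GIVEN `gkTrisection_exists_isMorse_isSelfIndexing` (hypothesis `h13`) and
`cerf_twistedSphere_four` (hypothesis `hC`): relabel the sectors to type `(0, g, 0)`
(`IsGKTrisection.comp_perm (Equiv.swap 0 1)`); the induced self-indexing Morse function has no
critical point of index `1`, `g - g = 0` of index `2` and none of index `3`, i.e. exactly two
critical points, so `M = D⁴ ∪_φ D⁴` is a twisted sphere (Milnor, *Morse theory*, Thm. 4.1 and the
Remark after it; `IsMorse.exists_isTwistedSphere_of_ncard_criticalSet_eq_two`) and `M ≅ S⁴` by
`Γ₄ = 0` (`nonempty_diffeomorph_sphere_four_of_isTwistedSphere_of_cerf`).  `M` is compact by the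
trisection, connected since simply connected (transported along `e`), oriented by Lee's Thm. 15.43.
[cite: GayKirby2016, Lemma 13 and Remark 5] [cite: Milnor1963, Thm. 4.1 and Remark (p. 25)]
[cite: CerfDiffeoSphere1968, Ch. I §1, Corollaire 1 (Γ₄ = 0)] -/
theorem lowGenusBase_sliceA_of_gkLemma13_of_cerf
    (h13 : Literature.Topology.FourManifolds.gkTrisection_exists_isMorse_isSelfIndexing) (hC : cerf_twistedSphere_four) :
    ∀ (M : Type) [TopologicalSpace M] [T2Space M] [SecondCountableTopology M]
      [ChartedSpace (EuclideanSpace ℝ (Fin 4)) M] [IsManifold (𝓡 4) ∞ M],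
      (M ≃ₕ Metric.sphere (0 : EuclideanSpace ℝ (Fin 5)) 1) →
      ∀ (g : ℕ) (k : Fin 3 → ℕ) (T : Fin 3 → Set M),
      IsGKTrisection M g k T → g ≤ 2 → k 0 = g → k 1 = 0 → k 2 = 0 →
      Nonempty (Diffeomorph (𝓡 4) (𝓡 4) M (Metric.sphere (0 : EuclideanSpace ℝ (Fin 5)) 1) ∞) := by
  intro M _ _ _ _ _ e g k T hT _hg h0 h1 h2
  haveI : CompactSpace M := hT.compactSpace
  haveI : SimplyConnectedSpace (Metric.sphere (0 : EuclideanSpace ℝ (Fin 5)) 1) :=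
    simplyConnectedSpace_sphere_four_holds
  haveI : SimplyConnectedSpace M := e.simplyConnectedSpace
  obtain ⟨o⟩ := isOrientable_of_homotopyEquiv_sphere_four_holds M e
  -- relabel the sectors: `(g, 0, 0) ↦ (0, g, 0)`
  have hT' := hT.comp_perm (Equiv.swap 0 1)
  obtain ⟨⟨h01a, h01b, h01c⟩, -, -⟩ := comp_swap_apply k
  obtain ⟨f, hf, -, hc0, hc1, hc2, hc3, hc4⟩ := h13 M o g _ _ hT'
  rw [h01a, h1] at hc1
  rw [h01b, h0, Nat.sub_self] at hc2
  rw [h01c, h2] at hc3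
  -- the critical set is `{p, q}`: the minimum and the maximum
  have hfin : (criticalSet (𝓡 4) f).Finite := IsMorse.finite_criticalSet_holds hf
  obtain ⟨p, hp⟩ := Set.ncard_eq_one.1 hc0
  obtain ⟨q, hq⟩ := Set.ncard_eq_one.1 hc4
  have hp0 : p ∈ criticalSetOfIndex (𝓡 4) f 0 := by rw [hp]; exact mem_singleton p
  have hq4 : q ∈ criticalSetOfIndex (𝓡 4) f 4 := by rw [hq]; exact mem_singleton q
  have hempty : ∀ i, (criticalSetOfIndex (𝓡 4) f i).ncard = 0 →
      criticalSetOfIndex (𝓡 4) f i = ∅ := fun i hi =>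
    (Set.ncard_eq_zero (hfin.subset (criticalSetOfIndex_subset _ f i))).1 hi
  have hcrit : criticalSet (𝓡 4) f = {p, q} := by
    apply Set.Subset.antisymm
    · intro x hx
      have hx4 : morseIndex (𝓡 4) f x ≤ 4 := by
        simpa [finrank_euclideanSpace_fin] using morseIndex_le_finrank (𝓡 4) f x
      obtain ⟨i, hi⟩ : ∃ i, morseIndex (𝓡 4) f x = i := ⟨_, rfl⟩
      have hmem : x ∈ criticalSetOfIndex (𝓡 4) f i := ⟨hx, hi⟩
      rw [hi] at hx4
      interval_cases i
      · rw [hp] at hmem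
        exact Or.inl hmem
      · rw [hempty 1 hc1] at hmem
        exact hmem.elim
      · rw [hempty 2 hc2] at hmem
        exact hmem.elim
      · rw [hempty 3 hc3] at hmem
        exact hmem.elim
      · rw [hq] at hmem
        exact Or.inr hmem
    · rintro x (rfl | rfl)
      · exact criticalSetOfIndex_subset _ f 0 hp0
      · exact criticalSetOfIndex_subset _ f 4 hq4
  have hpq : p ≠ q := by
    rintro rfl
    have h04 : (0 : ℕ) = 4 := hp0.2.symm.trans hq4.2
    omega
  have h2 : (criticalSet (𝓡 4) f).ncard = 2 := by rw [hcrit, Set.ncard_pair hpq]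
  obtain ⟨φ, hX⟩ := hf.exists_isTwistedSphere_of_ncard_criticalSet_eq_two (k := 3) (by norm_num) h2
  exact nonempty_diffeomorph_sphere_four_of_isTwistedSphere_of_cerf hC hX

/-- **Slice (B) from Gay–Kirby's Lemma 13, Property R and Laudenbach–Poénaru.**  A smooth
homotopy 4-sphere `M` (bare binders) with a `(2; 1, 1, 0)` Gay–Kirby trisection is diffeomorphic to
`S⁴`, GIVEN `gkTrisection_exists_isMorse_isSelfIndexing` (`h13`), the Property R handle fact
`propertyR_exists_isBoundaryGluing_sphere_four` (`hR`) and the Laudenbach–Poénaru extension fact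
`exists_diffeomorph_comp_incl_eq` (`hLP`): relabel the sectors to type `(0, 1, 1)`
(`Equiv.swap 0 2`); the induced self-indexing Morse function has critical-point counts
`(1, 0, 1, 1, 1)`; cutting `M` at the regular level `5/2` (`RegularSublevel.isBoundaryGluing_split`,
Milnor Thm. 3.1) writes `M = P ∪ V` with `P = {f ≤ 5/2}` a compact `(1, 0, 1)` 2-handlebody
(`B⁴ ∪ h²`, `RegularSublevel.hasHandleDecomposition`) and `V = {5/2 ≤ f}` a compact connected
orientable `(1, 1)`-handlebody (the `3`- and `4`-handle turned about, `IsMorse.criticalSetOfIndex_const_sub`);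
then `M ≅ S⁴` by Gompf–Scharlemann–Thompson's Prop. 9.2 for one 2-handle
(`nonempty_diffeomorph_sphere_of_isBoundaryGluing_oneTwoHandle_of_facts`: the knot trace `P` has
boundary `S¹ × S²`, so by Property R it closes up to the round `S⁴`, and by Laudenbach–Poénaru it
does not matter how `V` is attached) — the `g = 2` case of Meier–Schirmer–Zupan's Thm. 1.2.
[cite: GayKirby2016, Lemma 13] [cite: MeierSchirmerZupan2016, Thm. 1.2 and §4]
[cite: GompfScharlemannThompson2010, proof of Prop. 9.2 (n = 1) with Thm. 1.1]
[cite: GabaiJDG1987, Cor. 8.3] [cite: LaudenbachPoenaruBSMF1972, main theorem] -/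
theorem lowGenusBase_sliceB_of_gkLemma13_of_propertyR_of_laudenbachPoenaru
    (h13 : Literature.Topology.FourManifolds.gkTrisection_exists_isMorse_isSelfIndexing)
    (hR : propertyR_exists_isBoundaryGluing_sphere_four) (hLP : exists_diffeomorph_comp_incl_eq.{0}) :
    ∀ (M : Type) [TopologicalSpace M] [T2Space M] [SecondCountableTopology M]
      [ChartedSpace (EuclideanSpace ℝ (Fin 4)) M] [IsManifold (𝓡 4) ∞ M],
      (M ≃ₕ Metric.sphere (0 : EuclideanSpace ℝ (Fin 5)) 1) →
      ∀ (k : Fin 3 → ℕ) (T : Fin 3 → Set M),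
      IsGKTrisection M 2 k T → k 0 = 1 → k 1 = 1 → k 2 = 0 →
      Nonempty (Diffeomorph (𝓡 4) (𝓡 4) M (Metric.sphere (0 : EuclideanSpace ℝ (Fin 5)) 1) ∞) := by
  intro M _ _ _ _ _ e k T hT h0 h1 h2
  haveI : CompactSpace M := hT.compactSpace
  haveI : SimplyConnectedSpace (Metric.sphere (0 : EuclideanSpace ℝ (Fin 5)) 1) :=
    simplyConnectedSpace_sphere_four_holds
  haveI : SimplyConnectedSpace M := e.simplyConnectedSpace
  have hMo : IsOrientable (𝓡 4) M := isOrientable_of_homotopyEquiv_sphere_four_holds M e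
  obtain ⟨o⟩ := hMo
  -- relabel the sectors: `(1, 1, 0) ↦ (0, 1, 1)`
  have hT' := hT.comp_perm (Equiv.swap 0 2)
  obtain ⟨-, ⟨h02a, h02b, h02c⟩, -⟩ := comp_swap_apply k
  obtain ⟨f, hf, hsi, hc0, hc1, hc2, hc3, hc4⟩ := h13 M o 2 _ _ hT'
  rw [h02a, h2] at hc1
  rw [h02b, h1] at hc2
  rw [h02c, h0] at hc3
  -- `5/2` is a regular level
  have h : IsRegularLevel (𝓡 4) f (5 / 2) :=
    hf.isRegularLevel fun _ hz => hsi.apply_ne_of_lt_of_lt (m := 2) (by norm_num) (by norm_num) hz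
  -- the lower half `P = {f ≤ 5/2}`: one `0`-handle, one `2`-handle
  have hP : HasHandleDecomposition 3 (RegularSublevel h)
      (fun i => if i = 0 then 1 else if i = 2 then 1 else 0) := by
    have hd := RegularSublevel.hasHandleDecomposition hf h
    have hfun : (fun i => (criticalSetOfIndex (𝓡 4) f i ∩ f ⁻¹' Iic (5 / 2 : ℝ)).ncard) =
        fun i => if i = 0 then 1 else if i = 2 then 1 else 0 := by
      funext i
      rcases Nat.lt_or_ge i 3 with hi | hi
      · interval_cases i
        · rw [hsi.criticalSetOfIndex_inter_preimage_Iic_of_le (by norm_num), hc0]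
          rfl
        · rw [hsi.criticalSetOfIndex_inter_preimage_Iic_of_le (by norm_num), hc1]
          rfl
        · rw [hsi.criticalSetOfIndex_inter_preimage_Iic_of_le (by norm_num), hc2]
          rfl
      · have hi' : (5 / 2 : ℝ) < i := by
          have : (3 : ℝ) ≤ i := by exact_mod_cast hi
          linarith
        rw [hsi.criticalSetOfIndex_inter_preimage_Iic_of_lt hi', ncard_empty, if_neg (by omega),
          if_neg (by omega)]
    rw [hfun] at hd
    exact hd
  -- the upper half `V = {5/2 ≤ f}`: one `0`-handle (the `4`-handle) and one `1`-handle (the `3`-handle)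
  have hrank : Module.finrank ℝ (EuclideanSpace ℝ (Fin 4)) = 4 := finrank_euclideanSpace_fin
  have hV : HasHandleDecomposition 3 (RegularSuperlevel h) (handleCount 1 1) := by
    have hd := RegularSublevel.hasHandleDecomposition (hf.const_sub (5 / 2)) h.const_sub
    have hcs : ∀ {i : ℕ}, i ≤ 4 → criticalSetOfIndex (𝓡 4) (fun y => 5 / 2 - f y) i =
        criticalSetOfIndex (𝓡 4) f (4 - i) := fun {i} hi => by
      rw [hf.criticalSetOfIndex_const_sub (5 / 2) (by rw [hrank]; exact hi), hrank]
    have hfun : (fun i => (criticalSetOfIndex (𝓡 4) (fun y => 5 / 2 - f y) i ∩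
        (fun y => 5 / 2 - f y) ⁻¹' Iic (0 : ℝ)).ncard) = handleCount 1 1 := by
      funext i
      rcases Nat.lt_or_ge i 5 with hi | hi
      · interval_cases i
        · rw [hcs (by norm_num), hsi.criticalSetOfIndex_inter_superlevel_of_le (by norm_num), hc4]
          rfl
        · rw [hcs (by norm_num), hsi.criticalSetOfIndex_inter_superlevel_of_le (by norm_num), hc3]
          rfl
        · rw [hcs (by norm_num), hsi.criticalSetOfIndex_inter_superlevel_of_lt (by norm_num),
            ncard_empty]
          rfl
        · rw [hcs (by norm_num), hsi.criticalSetOfIndex_inter_superlevel_of_lt (by norm_num),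
            ncard_empty]
          rfl
        · rw [hcs (by norm_num), hsi.criticalSetOfIndex_inter_superlevel_of_lt (by norm_num),
            ncard_empty]
          rfl
      · rw [criticalSetOfIndex_eq_empty_of_finrank_lt (by rw [hrank]; omega), empty_inter,
          ncard_empty, handleCount, if_neg (by omega), if_neg (by omega)]
    rw [hfun] at hd
    exact hd
  have hoV : IsOrientable (𝓡∂ 4) (RegularSuperlevel h) := RegularSublevel.isOrientable h.const_sub ⟨o⟩
  obtain ⟨x₄, hx₄⟩ := Set.ncard_eq_one.1 hc4
  have h4' : (criticalSetOfIndex (𝓡 4) f 4).Subsingleton := by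
    rw [hx₄]; exact subsingleton_singleton
  have hfx₄ : f x₄ = 4 := by
    have hmem : x₄ ∈ criticalSetOfIndex (𝓡 4) f 4 := by rw [hx₄]; exact mem_singleton _
    have := hsi.apply_eq_of_mem_criticalSetOfIndex hmem
    simpa using this
  haveI : ConnectedSpace (RegularSuperlevel h) :=
    RegularSublevel.connectedSpace_superlevel hf h h4' ⟨x₄, by rw [hfx₄]; norm_num⟩
  exact nonempty_diffeomorph_sphere_of_isBoundaryGluing_oneTwoHandle_of_facts hR hLP
    (RegularSublevel h) (RegularSuperlevel h) hP hV hoV (RegularSublevel.isBoundaryGluing_split h)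

/-- **`LowGenusBase` from three leaves**: Gay–Kirby's Lemma 13 over `IsGKTrisection`
(`gkTrisection_exists_isMorse_isSelfIndexing`, new named fact), Property R in handle form
(`propertyR_exists_isBoundaryGluing_sphere_four`) and Laudenbach–Poénaru
(`exists_diffeomorph_comp_incl_eq`, which supplies Cerf's `Γ₄ = 0` for slice (A) through
`cerf_twistedSphere_four_of_exists_diffeomorph_comp_incl_eq`).  CONDITIONAL on the three named
facts; assembles `LowGenusBase_of_cases` with the two slices above.
[cite: GayKirby2016, Lemma 13] [cite: MeierSchirmerZupan2016, Thm. 1.2]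
[cite: GabaiJDG1987, Cor. 8.3] [cite: LaudenbachPoenaruBSMF1972, main theorem] -/
theorem LowGenusBase_of_gkLemma13_of_propertyR_of_laudenbachPoenaru
    (h13 : Literature.Topology.FourManifolds.gkTrisection_exists_isMorse_isSelfIndexing)
    (hR : propertyR_exists_isBoundaryGluing_sphere_four) (hLP : exists_diffeomorph_comp_incl_eq.{0}) :
    Summit.SmoothPoincare4.SmoothPoincare4.Theses.WeakReductionDescent.LowGenusBase :=
  LowGenusBase_of_cases
    (lowGenusBase_sliceA_of_gkLemma13_of_cerf h13
      (cerf_twistedSphere_four_of_exists_diffeomorph_comp_incl_eq hLP))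
    (lowGenusBase_sliceB_of_gkLemma13_of_propertyR_of_laudenbachPoenaru h13 hR hLP)

/-- **Hence the Meier–Zupan-range fact itself follows from the three leaves** (universe `0`):
`mz_genus_le_two_homotopySphere_gk.{0}` ⇐ Gay–Kirby Lemma 13 ∧ Property R (handle form) ∧
Laudenbach–Poénaru, through `LowGenusBase_iff_mz`.  A fact-decomposition record for the barrier
entry `LowGenusTrisectionsStandard` (which so far rested on `msz_homotopySphere_gk` alone).
[cite: MeierZupan2017, Thm. 1.2 (arXiv Thm. 1.3)] [cite: MeierSchirmerZupan2016, Thm. 1.2] -/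
theorem mz_genus_le_two_homotopySphere_gk_of_gkLemma13_of_propertyR_of_laudenbachPoenaru
    (h13 : Literature.Topology.FourManifolds.gkTrisection_exists_isMorse_isSelfIndexing)
    (hR : propertyR_exists_isBoundaryGluing_sphere_four) (hLP : exists_diffeomorph_comp_incl_eq.{0}) :
    Literature.Barriers.SmoothPoincare4.mz_genus_le_two_homotopySphere_gk.{0} :=
  mz_genus_le_two_homotopySphere_gk_of_LowGenusBase
    (LowGenusBase_of_gkLemma13_of_propertyR_of_laudenbachPoenaru h13 hR hLP)

end Summit.SmoothPoincare4.SmoothPoincare4.Theorems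

end
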